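/- Copyright: the b2b-balaban cell (near-miss cell 7), T⁴-continuum fan-out, lineage t4-ne7b-p1 (node U5c COUNT
member).  Released under the licence of the surrounding project. -/
import Summits.QuantumFields.BalabanUV.T4Continuum.Support.HistoryGenealogyPedigreeRealise

/-!
# THE PEDIGREE OF A COMPONENT HISTORY, part 5 (junction M4, brick 2c — the order): the OLDEST-FIRST CONTACT ORDER of
the constituents is CONSTRUCTED from the touch clause, and it satisfies `OrderOK`, `TouchOK` and — for histories without
fresh clusters — `HeadOK` (owner module of row NE7b, lineage `t4-ne7b-p1` gen 41; re-open object (α), `SCOPE-alpha.md`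
v2.2 §5 row M4, D-M4-2∕-3; located open point G-M4-1 displayed — PRE-POSITIONING ONLY)

Summits-side support leaf of the T⁴-continuum cell (rung (B)+1 on a FINITE torus only; NOT infinite volume, NOT the
mass gap, NOT the Clay statement; NOT a proof of the spine estimate NE7b, which is the cell's OWN estimate, NOT PRINTED
and NOT PROVED).  [folklore] finite combinatorics in the ℤᵈ index model over parts 1–4, brick 1
(`exists_touchPrefix_enum_from`), brick 2 of M3b-2 (`HistoryTouchComponents`: `LinkedIn`, `tcomp`, `gconn_tcomp`), row
S14's `ChainTouch` and leaf-05's `LevelClausesW`; nothing printed is asserted, no `def … : Prop` fact of Bałaban's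
(`NoFreshClusters` is a displayed hypothesis SHAPE on our data), zero `sorry`.  B16 = [Balaban1989LargeFieldII]
pp. 385–386 under audit; locators only.

WHY.  Parts 1–4 take the order of the part lists as a parameter `ord` with three displayed properties: `OrderOK` (a
permutation of print's constituents), `TouchOK` (prefix-touch form from the head: realisability of the left-nested
chain, part 4) and `HeadOK` (oldest old part first: `HeadOldest`, part 3).  THIS FILE constructs such an order: (§1) a
`ChainTouch` list (the leaf-first order of (G-touch)) has a CONNECTED touch graph on its members (`gconn_of_chainTouch`,
through the blocks of `HistoryTouchComponents`); (§2) hence, by brick 1's greedy enumeration from a prescribed member,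
every component's constituents admit a duplicate-free enumeration in prefix-touch order from ANY chosen head
(`exists_ordSpec`) — the head chosen = an old part of minimal extraction root step when the component has one, print's
first listed constituent otherwise; **`ordOf`** picks one by choice; (§3) `orderOK_ordOf`, `touchOK_ordOf`, and
`headOK_ordOf` under the displayed **`NoFreshClusters`** (every component of level `0`, and every component of ≥ 2
constituents, has … one constituent, resp. an old part — print's fresh touching clusters, p. 385, are the located
open point G-M4-1 of R-OWNER-41-4, outside the junction until the touch-birth window lands); (§4) the three parts
assembled: `realisesW_toPGen_ordOf`, `headOldest_pedOf_ordOf`, `forest_pedOf_ordOf`.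

HONEST.  Proves nothing of Bałaban's; `NoFreshClusters` is DISPLAYED, not hidden; NE7b NOT proved; spine 0∕9.  HONEST
DEPENDENCY (cell): continuum YM on T⁴ ⇐ BetaPertH ∧ nine spine estimates (0/9 proved); BetaPertH ⇐ (D1) ∧ (D4) ∧ CAP+tail;
G-an2-4 gates asym, D1 and NE2/3/4.  This file changes none of it. -/

open Finset
open Literature.MathematicalPhysics.QuantumFieldTheory.Balaban1983to89
open Literature.MathematicalPhysics.QuantumFieldTheory.Balaban1983to89.B13ScaleTransfer
open Literature.MathematicalPhysics.QuantumFieldTheory.Balaban1983to89.B16SProfile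
open Literature.MathematicalPhysics.QuantumFieldTheory.Balaban1983to89.B16MergeGeometry
open Literature.MathematicalPhysics.QuantumFieldTheory.Balaban1983to89.Step.Budget
open T4PersistenceDictionary
open Summit.QuantumFields.BalabanUV.T4Continuum.HistoryAdmissible
open Summit.QuantumFields.BalabanUV.T4Continuum.HistoryRealise
open Summit.QuantumFields.BalabanUV.T4Continuum.HistoryRealiseWeak
open Summit.QuantumFields.BalabanUV.T4Continuum.HistoryGen
open Summit.QuantumFields.BalabanUV.T4Continuum.HistoryGenealogyExtraction
open Summit.QuantumFields.BalabanUV.T4Continuum.HistoryGenealogyRealise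
open Summit.QuantumFields.BalabanUV.T4Continuum.HistoryGenealogyRealise.GeomHistoryR
open Summit.QuantumFields.BalabanUV.T4Continuum.HistoryTouchComponents

namespace Summit.QuantumFields.BalabanUV.T4Continuum.HistoryGenealogyPedigree

noncomputable section

open Classical

variable {d : ℕ}

/-! ## §1 A leaf-first touch chain has a connected touch graph -/

section Chain

variable {ι : Type*} [DecidableEq ι] (P : ι → Finset (Pt d))

omit [DecidableEq ι] in
/-- linkage inside a family is monotone in the family [folklore] -/
theorem linkedIn_mono {S S' : Finset ι} (h : S ⊆ S') {i j : ι} (hl : LinkedIn P S i j) : LinkedIn P S' i j := by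
  induction hl with
  | refl => exact LinkedIn.refl _
  | tail _ hbc ih => exact ih.trans (Relation.ReflTransGen.single ⟨h hbc.1, h hbc.2.1, hbc.2.2⟩)

/-- **EVERY MEMBER OF A `ChainTouch` LIST IS LINKED TO ITS LAST MEMBER** inside the list (each member touches the union
of the later ones: step to a later member, recurse). [folklore] -/
theorem linkedIn_getLast_of_chainTouch :
    ∀ (l : List ι) (hl : l ≠ []), ChainTouch (l.map P) → ∀ x ∈ l, LinkedIn P l.toFinset x (l.getLast hl)
  | [], hl, _ => (hl rfl).elim
  | [y], _, _ => by
      intro x hx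
      rw [List.mem_singleton] at hx
      subst hx
      exact LinkedIn.refl _
  | x₀ :: y :: l', hl0, hct => by
      have hne : (y :: l') ≠ [] := List.cons_ne_nil y l'
      rw [List.map_cons, List.map_cons, chainTouch_cons_cons] at hct
      obtain ⟨⟨a, ha, c, hc, hac⟩, hrest⟩ := hct
      rw [← List.map_cons] at hrest hc
      have ih := linkedIn_getLast_of_chainTouch (y :: l') hne hrest
      have hsub : (y :: l').toFinset ⊆ (x₀ :: y :: l').toFinset := by
        intro z hz; rw [List.mem_toFinset] at hz ⊢; exact List.mem_cons_of_mem _ hz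
      have hlast : (x₀ :: y :: l').getLast hl0 = (y :: l').getLast hne := List.getLast_cons hne
      intro x hx
      rw [hlast]
      rcases List.mem_cons.1 hx with rfl | hx
      · by_cases hx' : x ∈ y :: l'
        · exact linkedIn_mono P hsub (ih x hx')
        · obtain ⟨A, hA, hcA⟩ := mem_unionL.1 hc
          obtain ⟨z, hz, rfl⟩ := List.mem_map.1 hA
          have hxz : x ≠ z := fun h => hx' (h ▸ hz)
          have hstep : LinkedIn P (x :: y :: l').toFinset x z :=
            Relation.ReflTransGen.single ⟨by simp, List.mem_toFinset.2 (List.mem_cons_of_mem _ hz),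
              (touchGraph_adj P x z).2 ⟨hxz, a, ha, c, hcA, hac⟩⟩
          exact hstep.trans (linkedIn_mono P hsub (ih z hz))
      · exact linkedIn_mono P hsub (ih x hx)

/-- **A `ChainTouch` LIST HAS A CONNECTED TOUCH GRAPH** on its members (`Step.Budget.GConn`). [folklore] -/
theorem gconn_of_chainTouch {l : List ι} (hl : l ≠ []) (hct : ChainTouch (l.map P)) :
    GConn (touchGraph P) l.toFinset := by
  set i := l.getLast hl with hi
  have hiS : i ∈ l.toFinset := List.mem_toFinset.2 (List.getLast_mem hl)
  have heq : tcomp P l.toFinset i = l.toFinset := by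
    refine Finset.Subset.antisymm (tcomp_subset i) fun j hj => ?_
    exact mem_tcomp_iff.2 ⟨hj, (linkedIn_getLast_of_chainTouch P l hl hct j (List.mem_toFinset.1 hj)).symm⟩
  rw [← heq]
  exact gconn_tcomp hiS

end Chain

/-! ## §2 The order: specification, existence, choice -/

section Order

variable (H : ComponentHistory (Lab d)) (rnw : ℕ → Lab d → Bool) (dom : ℕ → Lab d → Finset (Pt d)) (L : ℕ)
  (s : ℕ → ℕ)

/-- **THE HEAD CONDITION** at a component `c` of level `j` for a constituent `q₀`: at a successor level with at least one
old part, `q₀` is an old part of minimal extraction root step among the parts; otherwise nothing. [folklore] -/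
def HeadCond : ℕ → Lab d → Lab d ⊕ Lab d → Prop
  | 0, _, _ => True
  | j + 1, c, q₀ => H.parts (j + 1) c ≠ [] →
      ∃ p₀, q₀ = Sum.inl p₀ ∧ ∀ p ∈ H.parts (j + 1) c, (H.pgenR rnw j p₀).rootStep ≤ (H.pgenR rnw j p).rootStep

/-- **THE ORDER SPECIFICATION** for the constituents of `c` at level `j`: duplicate-free, the same members as print's
list, prefix-touch from the head, head condition. [folklore] -/
def OrdSpec (j : ℕ) (c : Lab d) (l : List (Lab d ⊕ Lab d)) : Prop :=
  l.Nodup ∧ l.toFinset = (H.constit j c).toFinset ∧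
    ∀ q₀ q₁ qs, l = q₀ :: q₁ :: qs →
      TouchPrefix (imgC L s dom j q₀) ((q₁ :: qs).map (imgC L s dom j)) ∧ HeadCond H rnw j c q₀

/-- **THE CHOSEN ORDER**: a list meeting the specification if there is one, print's own list otherwise. [folklore] -/
def ordOf (j : ℕ) (c : Lab d) : List (Lab d ⊕ Lab d) :=
  if h : ∃ l, OrdSpec H rnw dom L s j c l then Classical.choose h else H.constit j c

variable {H rnw dom L s} {R : ℕ → ℕ}

/-- a head satisfying the head condition exists among the constituents of every component (under `WF`) [folklore] -/
theorem exists_head (hW : H.WF) {j : ℕ} {c : Lab d} (hc : c ∈ H.comp j) :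
    ∃ q₀ ∈ H.constit j c, HeadCond H rnw j c q₀ := by
  cases j with
  | zero =>
      obtain ⟨x, l, hxl⟩ := List.exists_cons_of_ne_nil (hW.nonempty 0 c hc)
      exact ⟨x, by rw [hxl]; exact List.mem_cons_self, trivial⟩
  | succ j =>
      by_cases hp : H.parts (j + 1) c = []
      · obtain ⟨x, l, hxl⟩ := List.exists_cons_of_ne_nil (hW.nonempty (j + 1) c hc)
        exact ⟨x, by rw [hxl]; exact List.mem_cons_self, fun h => (h hp).elim⟩
      · have hne : (H.parts (j + 1) c).toFinset.Nonempty := by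
          obtain ⟨p, ps, hps⟩ := List.exists_cons_of_ne_nil hp
          exact ⟨p, List.mem_toFinset.2 (by rw [hps]; exact List.mem_cons_self)⟩
        obtain ⟨p₀, hp₀, hmin⟩ :=
          Finset.exists_min_image (H.parts (j + 1) c).toFinset (fun p => (H.pgenR rnw j p).rootStep) hne
        refine ⟨Sum.inl p₀, (mem_lefts_iff p₀ _).1 (List.mem_toFinset.1 hp₀), fun _ => ⟨p₀, rfl, fun p hp' => ?_⟩⟩
        exact hmin p (List.mem_toFinset.2 hp')

/-- **AN ORDER MEETING THE SPECIFICATION EXISTS** for every component (under `WF` and the touch clause of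
`LevelClausesW`): one constituent — print's list itself; several — brick 1's greedy prefix-touch enumeration from the
chosen head on the connected touch graph of the leaf-first chain (§1). [folklore] -/
theorem exists_ordSpec (hW : H.WF) (hG : LevelClausesW H rnw dom L s R) {j : ℕ} {c : Lab d} (hc : c ∈ H.comp j) :
    ∃ l, OrdSpec H rnw dom L s j c l := by
  have hnd : (H.constit j c).Nodup := nodup_constit hW j c
  by_cases h2 : 2 ≤ (H.constit j c).length
  · obtain ⟨q₀, hq₀, hhead⟩ := exists_head (rnw := rnw) hW hc
    have hG' : GConn (touchGraph (imgC L s dom j)) (H.constit j c).toFinset :=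
      gconn_of_chainTouch (imgC L s dom j) (hW.nonempty j c hc) (hG.touch j c hc h2)
    obtain ⟨rest, hnd', hset, htp⟩ :=
      exists_touchPrefix_enum_from (imgC L s dom j) hG' (v₀ := q₀) (List.mem_toFinset.2 hq₀)
    refine ⟨q₀ :: rest, hnd', hset, fun r₀ r₁ rs hr => ?_⟩
    obtain ⟨rfl, hrest⟩ := List.cons.inj hr
    rw [← hrest]
    exact ⟨htp, hhead⟩
  · refine ⟨H.constit j c, hnd, rfl, fun q₀ q₁ qs hq => ?_⟩
    rw [hq] at h2; simp at h2

/-- the chosen order meets the specification (under `WF` and the clauses) [folklore] -/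
theorem ordSpec_ordOf (hW : H.WF) (hG : LevelClausesW H rnw dom L s R) {j : ℕ} {c : Lab d} (hc : c ∈ H.comp j) :
    OrdSpec H rnw dom L s j c (ordOf H rnw dom L s j c) := by
  have h := exists_ordSpec (rnw := rnw) hW hG hc
  unfold ordOf
  rw [dif_pos h]
  exact Classical.choose_spec h

/-! ## §3 The three displayed order properties, discharged -/

/-- **`OrderOK`** for the chosen order. [folklore] -/
theorem orderOK_ordOf (hW : H.WF) (hG : LevelClausesW H rnw dom L s R) : OrderOK H (ordOf H rnw dom L s) := by
  intro j c hc
  obtain ⟨hnd, hset, -⟩ := ordSpec_ordOf hW hG hc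
  exact List.perm_of_nodup_nodup_toFinset_eq hnd (nodup_constit hW j c) hset

/-- **`TouchOK`** for the chosen order. [folklore] -/
theorem touchOK_ordOf (hW : H.WF) (hG : LevelClausesW H rnw dom L s R) : TouchOK H (ordOf H rnw dom L s) dom L s := by
  intro j c hc q₀ q₁ qs hq
  obtain ⟨-, -, hspec⟩ := ordSpec_ordOf hW hG hc
  exact (hspec q₀ q₁ qs hq).1

variable (H) in
/-- **THE DISPLAYED CONDITION «NO FRESH CLUSTERS»**: every component of level `0` has ONE constituent, and every
component of a successor level with at least two constituents has an OLD part (located open point G-M4-1 of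
R-OWNER-41-4: print's components made of several NEW regions only, B16 p. 385, are outside the junction until the
touch-birth window lands — then they enter as ONE birth and this condition holds of the clustered input). [folklore] -/
structure NoFreshClusters : Prop where
  /-- level-0 components have one constituent -/
  zero : ∀ c, c ∈ H.comp 0 → (H.constit 0 c).length ≤ 1
  /-- a component of ≥ 2 constituents has an old part -/
  succ : ∀ j c, c ∈ H.comp (j + 1) → 2 ≤ (H.constit (j + 1) c).length → H.parts (j + 1) c ≠ []

/-- **`HeadOK`** for the chosen order, under «no fresh clusters». [folklore] -/
theorem headOK_ordOf (hW : H.WF) (hG : LevelClausesW H rnw dom L s R) (hN : NoFreshClusters H) :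
    HeadOK H rnw (ordOf H rnw dom L s) where
  zero := hN.zero
  succ j c hc q₀ q₁ qs hq := by
    obtain ⟨-, -, hspec⟩ := ordSpec_ordOf hW hG hc
    have h2 : 2 ≤ (H.constit (j + 1) c).length := two_le_length_constit_of_ord (orderOK_ordOf hW hG) hc hq
    exact (hspec q₀ q₁ qs hq).2 (hN.succ j c hc h2)

/-! ## §4 Assembly: the pedigree of print's bookkeeping in the chosen order -/

/-- **REALISATION**: every component's `toPGen id` (chosen order) is `RealisesW`-realised by its last-event domain, and
the current domain is the orbit from the last step — NO fresh-cluster condition. [folklore] -/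
theorem realisesW_toPGen_ordOf (hW : H.WF) (hG : LevelClausesW H rnw dom L s R) {j : ℕ} {c : Lab d} (hc : c ∈ H.comp j) :
    RealisesW L s R ((pedOf H rnw (ordOf H rnw dom L s)).toPGen id (j, c)) (edomR H rnw dom j c) ∧
      dom j c = orbit L s ((pedOf H rnw (ordOf H rnw dom L s)).toPGen id (j, c)).lastStep (edomR H rnw dom j c)
        (j - ((pedOf H rnw (ordOf H rnw dom L s)).toPGen id (j, c)).lastStep) :=
  realisesW_toPGen hW (orderOK_ordOf hW hG) (touchOK_ordOf hW hG) hG j c hc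

/-- **FOREST** for every name (chosen order). [folklore] -/
theorem forest_pedOf_ordOf (hW : H.WF) (hG : LevelClausesW H rnw dom L s R) (c : ℕ × Lab d) :
    (pedOf H rnw (ordOf H rnw dom L s)).Forest c :=
  forest_pedOf hW (orderOK_ordOf hW hG) c

/-- **OLDEST LINE FIRST** for every name (chosen order), under «no fresh clusters». [folklore] -/
theorem headOldest_pedOf_ordOf (hW : H.WF) (hG : LevelClausesW H rnw dom L s R) (hN : NoFreshClusters H) (c : ℕ × Lab d) :
    (pedOf H rnw (ordOf H rnw dom L s)).HeadOldest c :=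
  headOldest_pedOf hW (orderOK_ordOf hW hG) (headOK_ordOf hW hG hN) c

/-- the last step of a live component's `toPGen` (chosen order) is at most its level, and is print's extraction's
[folklore] -/
theorem lastStep_toPGen_ordOf (hW : H.WF) (hG : LevelClausesW H rnw dom L s R) {j : ℕ} {c : Lab d} (hc : c ∈ H.comp j) :
    ((pedOf H rnw (ordOf H rnw dom L s)).toPGen id (j, c)).lastStep = (H.pgenR rnw j c).lastStep ∧
      ((pedOf H rnw (ordOf H rnw dom L s)).toPGen id (j, c)).lastStep ≤ j :=
  ⟨lastStep_toPGen_eq_pgenR id hW (orderOK_ordOf hW hG) j c hc, lastStep_toPGen_le id hW (orderOK_ordOf hW hG) hc⟩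

end Order

end

end Summit.QuantumFields.BalabanUV.T4Continuum.HistoryGenealogyPedigree
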